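import Mathlib
import Summits.AnomalousDissipation.AnomalousDissipation.Theorems.DyadicWallCascadeViscousContinuationStubNoFastBlowDownCellTools
import Summits.AnomalousDissipation.AnomalousDissipation.Theorems.DyadicWallCascadeViscousContinuationStubNoFastBlowDownSliceTools
import Summits.AnomalousDissipation.AnomalousDissipation.Theorems.DyadicWallCascadeViscousContinuationStubNoFastBlowDownParamTools
import Summits.AnomalousDissipation.AnomalousDissipation.Theorems.DyadicWallCascadeViscousContinuationStubNoFastBlowDownWeylTools
import HarnessLib

/-!
# Harmonic-endgame tools I (slice identity) for the rate obstruction `NoFastBlowDown`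

Crux `Summit.AnomalousDissipation.AnomalousDissipation.Theses.DyadicWallCascade.ViscousContinuation`
(stmt-AnomalousDissipation-17917, line SketchIdeator4, lead c1).

The rate obstruction says that the dyadic blow-down of a viscous wall profile cannot converge to
its hierarchy faster than the viscous rate `2⁻ᵐ`.  If it did, the hierarchy would be HARMONIC on
the fundamental band, and the endgame (`NoFastBlowDownHarmonic.lean`) shows that a harmonic
hierarchy has zero energy flux.  The endgame is one-variable calculus in the height `z` for the
horizontal cell averages of a globally smooth field `U : ℝ³ → ℝ³` taken against the weight
`ρ(x, y) = k(x) k(y)`, `k` the two-cell partition-of-unity profile of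
`noFastBlowDown_cell_profile`.  This file supplies the first of its two non-trivial inputs,
the SLICE IDENTITY `noFastBlowDown_harm_slice_identity`: for a height `z` at which `U` is harmonic
and its horizontal slices are `1`-periodic,
`∫ρ ⟪U, ∂₂∂₂U⟫ = ∫ρ (‖∂₀U‖² + ‖∂₁U‖²)` (harmonicity turns `∂₂∂₂U` into `-∂₀∂₀U - ∂₁∂₁U`;
weighted integration by parts on each horizontal line, `noFastBlowDown_harm_ibp_zero/one`; the
`k′`-terms vanish EXACTLY against the `1`-periodic slices).  The file ends with the registered
tools stub `stub_noFastBlowDownHarmonicSliceTools`.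
-/

open MeasureTheory Set Filter Topology Function
open scoped RealInnerProductSpace

set_option linter.dupNamespace false

noncomputable section

namespace Summit.AnomalousDissipation.AnomalousDissipation.Theorems

/-! ## Coordinate bookkeeping on `ℝ³` -/

/-- Translating the first coordinate: `(x, y, z) + c e₀ = (x + c, y, z)`. [folklore] -/
theorem noFastBlowDown_harm_pt_add_zero (x y z c : ℝ) :
    (!₂[x, y, z] : EuclideanSpace ℝ (Fin 3)) + c • EuclideanSpace.single 0 (1 : ℝ) =
      !₂[x + c, y, z] := by
  ext i; fin_cases i <;> simp

/-- Translating the second coordinate: `(x, y, z) + c e₁ = (x, y + c, z)`. [folklore] -/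
theorem noFastBlowDown_harm_pt_add_one (x y z c : ℝ) :
    (!₂[x, y, z] : EuclideanSpace ℝ (Fin 3)) + c • EuclideanSpace.single 1 (1 : ℝ) =
      !₂[x, y + c, z] := by
  ext i; fin_cases i <;> simp

/-! ## The slice identity: harmonicity plus horizontal integration by parts -/

/-- **Weighted horizontal integration by parts in `X₀`.**  For a smooth field `U` on `ℝ³` whose
slices `x ↦ U (x, y, z)` at height `z` are `1`-periodic, and the two-cell profile `k` with
derivative `k'` (as in `noFastBlowDown_cell_profile`),
`∫∫ k(x)k(y) ⟪U, ∂₀∂₀U⟫ (x, y, z) = -∫∫ k(x)k(y) ‖∂₀U‖² (x, y, z)`: on each line integrate by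
parts (`noFastBlowDown_line_ibp`); the term `∫ k′ ⟪U, ∂₀U⟫` vanishes exactly because
`⟪U, ∂₀U⟫` is `1`-periodic (`noFastBlowDown_cell_integral_deriv`). [folklore] -/
theorem noFastBlowDown_harm_ibp_zero (U : EuclideanSpace ℝ (Fin 3) → EuclideanSpace ℝ (Fin 3))
    (hU : ContDiff ℝ ((⊤ : ℕ∞) : WithTop ℕ∞) U) (k k' : ℝ → ℝ) (hk : Continuous k)
    (hk' : Continuous k') (hkd : ∀ t, HasDerivAt k (k' t) t) (hk0 : ∀ t, t ≤ 0 → k t = 0)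
    (hk2 : ∀ t, 2 ≤ t → k t = 0) (hk1 : ∀ t, 0 ≤ t → t ≤ 1 → k t + k (t + 1) = 1)
    (hk'0 : ∀ t, t ≤ 0 → k' t = 0) (hk'2 : ∀ t, 2 ≤ t → k' t = 0)
    (hk'1 : ∀ t, 0 ≤ t → t ≤ 1 → k' t + k' (t + 1) = 0) (z : ℝ)
    (hperz : ∀ x y : ℝ, U (!₂[x, y, z] + EuclideanSpace.single 0 (1 : ℝ)) = U !₂[x, y, z]) :
    ∫ q : ℝ × ℝ, k q.1 * k q.2 * ⟪U !₂[q.1, q.2, z],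
        fderiv ℝ (fun Y => fderiv ℝ U Y (EuclideanSpace.single 0 (1 : ℝ))) !₂[q.1, q.2, z]
          (EuclideanSpace.single 0 (1 : ℝ))⟫ =
      -∫ q : ℝ × ℝ, k q.1 * k q.2 *
        ‖fderiv ℝ U !₂[q.1, q.2, z] (EuclideanSpace.single 0 (1 : ℝ))‖ ^ 2 := by
  set e0 : EuclideanSpace ℝ (Fin 3) := EuclideanSpace.single 0 (1 : ℝ) with he0
  -- compact supports of the profile and of its derivative
  have hkc : HasCompactSupport k :=
    HasCompactSupport.of_support_subset_isCompact (isCompact_Icc (a := (0 : ℝ)) (b := 2))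
      fun t ht => by
        rw [mem_support] at ht
        exact ⟨by by_contra h; exact ht (hk0 t (not_le.1 h).le),
          by by_contra h; exact ht (hk2 t (not_le.1 h).le)⟩
  have hkc' : HasCompactSupport k' :=
    HasCompactSupport.of_support_subset_isCompact (isCompact_Icc (a := (0 : ℝ)) (b := 2))
      fun t ht => by
        rw [mem_support] at ht
        exact ⟨by by_contra h; exact ht (hk'0 t (not_le.1 h).le),
          by by_contra h; exact ht (hk'2 t (not_le.1 h).le)⟩
  -- regularity of the fields involved
  have hU1 : ContDiff ℝ 1 U := contDiff_infty.1 hU 1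
  have hD : ContDiff ℝ ((⊤ : ℕ∞) : WithTop ℕ∞) fun Y => fderiv ℝ U Y e0 :=
    noFastBlowDown_weyl_contDiff_fderiv_apply hU e0
  have hD1 : ContDiff ℝ 1 fun Y => fderiv ℝ U Y e0 := contDiff_infty.1 hD 1
  have hDD : ContDiff ℝ ((⊤ : ℕ∞) : WithTop ℕ∞) fun Y => fderiv ℝ (fun Z => fderiv ℝ U Z e0) Y e0 :=
    noFastBlowDown_weyl_contDiff_fderiv_apply hD e0
  -- the three continuous integrands on `ℝ³`
  set A : EuclideanSpace ℝ (Fin 3) → ℝ := fun Y =>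
    ⟪U Y, fderiv ℝ (fun Z => fderiv ℝ U Z e0) Y e0⟫ with hA
  set B : EuclideanSpace ℝ (Fin 3) → ℝ := fun Y => ‖fderiv ℝ U Y e0‖ ^ 2 with hB
  have hAc : Continuous A := hU.continuous.inner hDD.continuous
  have hBc : Continuous B := (hD.continuous.norm).pow 2
  -- Fubini with the `x`-integral inside
  have hIA := noFastBlowDown_param_integrable k A hk hkc hAc z
  have hIB := noFastBlowDown_param_integrable k B hk hkc hBc z
  rw [show (∫ q : ℝ × ℝ, k q.1 * k q.2 * ⟪U !₂[q.1, q.2, z],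
      fderiv ℝ (fun Y => fderiv ℝ U Y e0) !₂[q.1, q.2, z] e0⟫) =
      ∫ q : ℝ × ℝ, k q.1 * k q.2 * A !₂[q.1, q.2, z] from rfl,
    show (∫ q : ℝ × ℝ, k q.1 * k q.2 * ‖fderiv ℝ U !₂[q.1, q.2, z] e0‖ ^ 2) =
      ∫ q : ℝ × ℝ, k q.1 * k q.2 * B !₂[q.1, q.2, z] from rfl]
  rw [Measure.volume_eq_prod, integral_prod_symm _ hIA, integral_prod_symm _ hIB,
    ← integral_neg]
  refine integral_congr_ae (Eventually.of_forall fun y => ?_)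
  simp only
  -- the line at height `z`, ordinate `y`
  set u : ℝ → EuclideanSpace ℝ (Fin 3) := fun x => U !₂[x, y, z] with hu
  set u' : ℝ → EuclideanSpace ℝ (Fin 3) := fun x => fderiv ℝ U !₂[x, y, z] e0 with hu'
  set u'' : ℝ → EuclideanSpace ℝ (Fin 3) := fun x =>
    fderiv ℝ (fun Z => fderiv ℝ U Z e0) !₂[x, y, z] e0 with hu''
  have hud : ∀ x, HasDerivAt u (u' x) x := fun x =>
    (noFastBlowDown_slice_hasDerivAt_vec U hU1 x y z).1
  have hud' : ∀ x, HasDerivAt u' (u'' x) x := fun x =>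
    (noFastBlowDown_slice_hasDerivAt_vec (fun Y => fderiv ℝ U Y e0) hD1 x y z).1
  have hu''c : Continuous u'' := hDD.continuous.comp (by fun_prop)
  have hibp := noFastBlowDown_line_ibp k k' u u' u'' hk hk' hkc hkc' hkd hud hud' hu''c
  -- the `k′`-term vanishes by periodicity
  have hper_u : ∀ x, u (x + 1) = u x := fun x => by
    simp only [hu]
    rw [← noFastBlowDown_harm_pt_add_zero x y z 1, one_smul]
    exact hperz x y
  have hper_u' : ∀ x, u' (x + 1) = u' x := noFastBlowDown_deriv_periodic u u' 1 hud hper_u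
  have hvan : ∫ x, k' x * ⟪u x, u' x⟫ = 0 :=
    noFastBlowDown_cell_integral_deriv k k' (fun x => ⟪u x, u' x⟫) hk hk'
      ((continuous_iff_continuousAt.2 fun x => (hud x).continuousAt).inner
        (continuous_iff_continuousAt.2 fun x => (hud' x).continuousAt))
      hk0 hk2 hk1 hk'0 hk'2 hk'1 (fun x => by simp only [hper_u, hper_u'])
  -- assemble the line identity
  have hL : ∫ x, k x * k y * A !₂[x, y, z] = k y * ∫ x, k x * ⟪u x, u'' x⟫ := by
    rw [← integral_const_mul]
    exact integral_congr_ae (Eventually.of_forall fun x => by simp only [hA, hu, hu'']; ring)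
  have hR : ∫ x, k x * k y * B !₂[x, y, z] = k y * ∫ x, k x * ‖u' x‖ ^ 2 := by
    rw [← integral_const_mul]
    exact integral_congr_ae (Eventually.of_forall fun x => by simp only [hB, hu']; ring)
  rw [hL, hR, hibp, hvan, sub_zero, mul_neg]

/-- **Weighted horizontal integration by parts in `X₁`** (the same identity in the second
horizontal variable, with the `y`-integral inside). [folklore] -/
theorem noFastBlowDown_harm_ibp_one (U : EuclideanSpace ℝ (Fin 3) → EuclideanSpace ℝ (Fin 3))
    (hU : ContDiff ℝ ((⊤ : ℕ∞) : WithTop ℕ∞) U) (k k' : ℝ → ℝ) (hk : Continuous k)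
    (hk' : Continuous k') (hkd : ∀ t, HasDerivAt k (k' t) t) (hk0 : ∀ t, t ≤ 0 → k t = 0)
    (hk2 : ∀ t, 2 ≤ t → k t = 0) (hk1 : ∀ t, 0 ≤ t → t ≤ 1 → k t + k (t + 1) = 1)
    (hk'0 : ∀ t, t ≤ 0 → k' t = 0) (hk'2 : ∀ t, 2 ≤ t → k' t = 0)
    (hk'1 : ∀ t, 0 ≤ t → t ≤ 1 → k' t + k' (t + 1) = 0) (z : ℝ)
    (hperz : ∀ x y : ℝ, U (!₂[x, y, z] + EuclideanSpace.single 1 (1 : ℝ)) = U !₂[x, y, z]) :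
    ∫ q : ℝ × ℝ, k q.1 * k q.2 * ⟪U !₂[q.1, q.2, z],
        fderiv ℝ (fun Y => fderiv ℝ U Y (EuclideanSpace.single 1 (1 : ℝ))) !₂[q.1, q.2, z]
          (EuclideanSpace.single 1 (1 : ℝ))⟫ =
      -∫ q : ℝ × ℝ, k q.1 * k q.2 *
        ‖fderiv ℝ U !₂[q.1, q.2, z] (EuclideanSpace.single 1 (1 : ℝ))‖ ^ 2 := by
  set e1 : EuclideanSpace ℝ (Fin 3) := EuclideanSpace.single 1 (1 : ℝ) with he1
  have hkc : HasCompactSupport k :=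
    HasCompactSupport.of_support_subset_isCompact (isCompact_Icc (a := (0 : ℝ)) (b := 2))
      fun t ht => by
        rw [mem_support] at ht
        exact ⟨by by_contra h; exact ht (hk0 t (not_le.1 h).le),
          by by_contra h; exact ht (hk2 t (not_le.1 h).le)⟩
  have hkc' : HasCompactSupport k' :=
    HasCompactSupport.of_support_subset_isCompact (isCompact_Icc (a := (0 : ℝ)) (b := 2))
      fun t ht => by
        rw [mem_support] at ht
        exact ⟨by by_contra h; exact ht (hk'0 t (not_le.1 h).le),
          by by_contra h; exact ht (hk'2 t (not_le.1 h).le)⟩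
  have hU1 : ContDiff ℝ 1 U := contDiff_infty.1 hU 1
  have hD : ContDiff ℝ ((⊤ : ℕ∞) : WithTop ℕ∞) fun Y => fderiv ℝ U Y e1 :=
    noFastBlowDown_weyl_contDiff_fderiv_apply hU e1
  have hD1 : ContDiff ℝ 1 fun Y => fderiv ℝ U Y e1 := contDiff_infty.1 hD 1
  have hDD : ContDiff ℝ ((⊤ : ℕ∞) : WithTop ℕ∞) fun Y => fderiv ℝ (fun Z => fderiv ℝ U Z e1) Y e1 :=
    noFastBlowDown_weyl_contDiff_fderiv_apply hD e1
  set A : EuclideanSpace ℝ (Fin 3) → ℝ := fun Y =>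
    ⟪U Y, fderiv ℝ (fun Z => fderiv ℝ U Z e1) Y e1⟫ with hA
  set B : EuclideanSpace ℝ (Fin 3) → ℝ := fun Y => ‖fderiv ℝ U Y e1‖ ^ 2 with hB
  have hAc : Continuous A := hU.continuous.inner hDD.continuous
  have hBc : Continuous B := (hD.continuous.norm).pow 2
  have hIA := noFastBlowDown_param_integrable k A hk hkc hAc z
  have hIB := noFastBlowDown_param_integrable k B hk hkc hBc z
  rw [show (∫ q : ℝ × ℝ, k q.1 * k q.2 * ⟪U !₂[q.1, q.2, z],
      fderiv ℝ (fun Y => fderiv ℝ U Y e1) !₂[q.1, q.2, z] e1⟫) =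
      ∫ q : ℝ × ℝ, k q.1 * k q.2 * A !₂[q.1, q.2, z] from rfl,
    show (∫ q : ℝ × ℝ, k q.1 * k q.2 * ‖fderiv ℝ U !₂[q.1, q.2, z] e1‖ ^ 2) =
      ∫ q : ℝ × ℝ, k q.1 * k q.2 * B !₂[q.1, q.2, z] from rfl]
  rw [Measure.volume_eq_prod, integral_prod _ hIA, integral_prod _ hIB, ← integral_neg]
  refine integral_congr_ae (Eventually.of_forall fun x => ?_)
  simp only
  -- the line at height `z`, abscissa `x`
  set u : ℝ → EuclideanSpace ℝ (Fin 3) := fun y => U !₂[x, y, z] with hu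
  set u' : ℝ → EuclideanSpace ℝ (Fin 3) := fun y => fderiv ℝ U !₂[x, y, z] e1 with hu'
  set u'' : ℝ → EuclideanSpace ℝ (Fin 3) := fun y =>
    fderiv ℝ (fun Z => fderiv ℝ U Z e1) !₂[x, y, z] e1 with hu''
  have hud : ∀ y, HasDerivAt u (u' y) y := fun y =>
    (noFastBlowDown_slice_hasDerivAt_vec U hU1 x y z).2.1
  have hud' : ∀ y, HasDerivAt u' (u'' y) y := fun y =>
    (noFastBlowDown_slice_hasDerivAt_vec (fun Y => fderiv ℝ U Y e1) hD1 x y z).2.1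
  have hu''c : Continuous u'' := hDD.continuous.comp (by fun_prop)
  have hibp := noFastBlowDown_line_ibp k k' u u' u'' hk hk' hkc hkc' hkd hud hud' hu''c
  have hper_u : ∀ y, u (y + 1) = u y := fun y => by
    simp only [hu]
    rw [← noFastBlowDown_harm_pt_add_one x y z 1, one_smul]
    exact hperz x y
  have hper_u' : ∀ y, u' (y + 1) = u' y := noFastBlowDown_deriv_periodic u u' 1 hud hper_u
  have hvan : ∫ y, k' y * ⟪u y, u' y⟫ = 0 :=
    noFastBlowDown_cell_integral_deriv k k' (fun y => ⟪u y, u' y⟫) hk hk'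
      ((continuous_iff_continuousAt.2 fun y => (hud y).continuousAt).inner
        (continuous_iff_continuousAt.2 fun y => (hud' y).continuousAt))
      hk0 hk2 hk1 hk'0 hk'2 hk'1 (fun y => by simp only [hper_u, hper_u'])
  have hL : ∫ y, k x * k y * A !₂[x, y, z] = k x * ∫ y, k y * ⟪u y, u'' y⟫ := by
    rw [← integral_const_mul]
    exact integral_congr_ae (Eventually.of_forall fun y => by simp only [hA, hu, hu'']; ring)
  have hR : ∫ y, k x * k y * B !₂[x, y, z] = k x * ∫ y, k y * ‖u' y‖ ^ 2 := by
    rw [← integral_const_mul]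
    exact integral_congr_ae (Eventually.of_forall fun y => by simp only [hB, hu']; ring)
  rw [hL, hR, hibp, hvan, sub_zero, mul_neg]


/-- **The slice identity.**  Let `U` be smooth on `ℝ³`, harmonic at height `z`
(`Σᵢ ∂ᵢ∂ᵢU = 0` on the plane `X₂ = z`) with `1`-periodic slices at height `z` in both horizontal
variables.  Then `∫∫ k(x)k(y) ⟪U, ∂₂∂₂U⟫ (x, y, z) = ∫∫ k(x)k(y) (‖∂₀U‖² + ‖∂₁U‖²) (x, y, z)`:
harmonicity replaces `∂₂∂₂U` by `-∂₀∂₀U - ∂₁∂₁U`, and the two horizontal integrations by parts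
`noFastBlowDown_harm_ibp_zero/one` have no boundary or `k′` terms. [folklore] -/
theorem noFastBlowDown_harm_slice_identity
    (U : EuclideanSpace ℝ (Fin 3) → EuclideanSpace ℝ (Fin 3))
    (hU : ContDiff ℝ ((⊤ : ℕ∞) : WithTop ℕ∞) U) (k k' : ℝ → ℝ) (hk : Continuous k)
    (hk' : Continuous k') (hkd : ∀ t, HasDerivAt k (k' t) t) (hk0 : ∀ t, t ≤ 0 → k t = 0)
    (hk2 : ∀ t, 2 ≤ t → k t = 0) (hk1 : ∀ t, 0 ≤ t → t ≤ 1 → k t + k (t + 1) = 1)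
    (hk'0 : ∀ t, t ≤ 0 → k' t = 0) (hk'2 : ∀ t, 2 ≤ t → k' t = 0)
    (hk'1 : ∀ t, 0 ≤ t → t ≤ 1 → k' t + k' (t + 1) = 0) (z : ℝ)
    (hharmz : ∀ x y : ℝ, ∑ i : Fin 3, fderiv ℝ (fun Y => fderiv ℝ U Y (EuclideanSpace.single i (1 : ℝ)))
      !₂[x, y, z] (EuclideanSpace.single i (1 : ℝ)) = 0)
    (hper0 : ∀ x y : ℝ, U (!₂[x, y, z] + EuclideanSpace.single 0 (1 : ℝ)) = U !₂[x, y, z])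
    (hper1 : ∀ x y : ℝ, U (!₂[x, y, z] + EuclideanSpace.single 1 (1 : ℝ)) = U !₂[x, y, z]) :
    ∫ q : ℝ × ℝ, k q.1 * k q.2 * ⟪U !₂[q.1, q.2, z],
        fderiv ℝ (fun Y => fderiv ℝ U Y (EuclideanSpace.single 2 (1 : ℝ))) !₂[q.1, q.2, z]
          (EuclideanSpace.single 2 (1 : ℝ))⟫ =
      ∫ q : ℝ × ℝ, k q.1 * k q.2 *
        (‖fderiv ℝ U !₂[q.1, q.2, z] (EuclideanSpace.single 0 (1 : ℝ))‖ ^ 2 +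
          ‖fderiv ℝ U !₂[q.1, q.2, z] (EuclideanSpace.single 1 (1 : ℝ))‖ ^ 2) := by
  set e : Fin 3 → EuclideanSpace ℝ (Fin 3) := fun i => EuclideanSpace.single i (1 : ℝ) with he
  have hkc : HasCompactSupport k :=
    HasCompactSupport.of_support_subset_isCompact (isCompact_Icc (a := (0 : ℝ)) (b := 2))
      fun t ht => by
        rw [mem_support] at ht
        exact ⟨by by_contra h; exact ht (hk0 t (not_le.1 h).le),
          by by_contra h; exact ht (hk2 t (not_le.1 h).le)⟩
  -- second partial derivatives as continuous fields
  have hD : ∀ i, ContDiff ℝ ((⊤ : ℕ∞) : WithTop ℕ∞) fun Y => fderiv ℝ U Y (e i) := fun i =>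
    noFastBlowDown_weyl_contDiff_fderiv_apply hU (e i)
  have hDD : ∀ i, ContDiff ℝ ((⊤ : ℕ∞) : WithTop ℕ∞)
      fun Y => fderiv ℝ (fun Z => fderiv ℝ U Z (e i)) Y (e i) := fun i =>
    noFastBlowDown_weyl_contDiff_fderiv_apply (hD i) (e i)
  set A : Fin 3 → EuclideanSpace ℝ (Fin 3) → ℝ := fun i Y =>
    ⟪U Y, fderiv ℝ (fun Z => fderiv ℝ U Z (e i)) Y (e i)⟫ with hA
  set B : Fin 3 → EuclideanSpace ℝ (Fin 3) → ℝ := fun i Y => ‖fderiv ℝ U Y (e i)‖ ^ 2 with hB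
  have hAc : ∀ i, Continuous (A i) := fun i => hU.continuous.inner (hDD i).continuous
  have hBc : ∀ i, Continuous (B i) := fun i => ((hD i).continuous.norm).pow 2
  have hIA : ∀ i, Integrable fun q : ℝ × ℝ => k q.1 * k q.2 * A i !₂[q.1, q.2, z] := fun i =>
    noFastBlowDown_param_integrable k (A i) hk hkc (hAc i) z
  have hIB : ∀ i, Integrable fun q : ℝ × ℝ => k q.1 * k q.2 * B i !₂[q.1, q.2, z] := fun i =>
    noFastBlowDown_param_integrable k (B i) hk hkc (hBc i) z
  -- harmonicity pointwise: `A 2 = -A 0 - A 1` at height `z`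
  have hharm' : ∀ x y : ℝ, A 2 !₂[x, y, z] = -A 0 !₂[x, y, z] - A 1 !₂[x, y, z] := by
    intro x y
    have h := hharmz x y
    rw [Fin.sum_univ_three] at h
    simp only [hA]
    rw [← inner_neg_right, ← inner_sub_right]
    congr 1
    rw [eq_sub_iff_add_eq, eq_neg_iff_add_eq_zero, ← h]
    simp only [he]
    abel
  -- the two horizontal integrations by parts
  have h0 := noFastBlowDown_harm_ibp_zero U hU k k' hk hk' hkd hk0 hk2 hk1 hk'0 hk'2 hk'1 z hper0
  have h1 := noFastBlowDown_harm_ibp_one U hU k k' hk hk' hkd hk0 hk2 hk1 hk'0 hk'2 hk'1 z hper1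
  change ∫ q : ℝ × ℝ, k q.1 * k q.2 * A 0 !₂[q.1, q.2, z] =
    -∫ q : ℝ × ℝ, k q.1 * k q.2 * B 0 !₂[q.1, q.2, z] at h0
  change ∫ q : ℝ × ℝ, k q.1 * k q.2 * A 1 !₂[q.1, q.2, z] =
    -∫ q : ℝ × ℝ, k q.1 * k q.2 * B 1 !₂[q.1, q.2, z] at h1
  change ∫ q : ℝ × ℝ, k q.1 * k q.2 * A 2 !₂[q.1, q.2, z] =
    ∫ q : ℝ × ℝ, k q.1 * k q.2 * (B 0 !₂[q.1, q.2, z] + B 1 !₂[q.1, q.2, z])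
  calc ∫ q : ℝ × ℝ, k q.1 * k q.2 * A 2 !₂[q.1, q.2, z]
      = ∫ q : ℝ × ℝ, (-(k q.1 * k q.2 * A 0 !₂[q.1, q.2, z]) -
          k q.1 * k q.2 * A 1 !₂[q.1, q.2, z]) := by
        refine integral_congr_ae (Eventually.of_forall fun q => ?_)
        simp only [hharm']
        ring
    _ = -(∫ q : ℝ × ℝ, k q.1 * k q.2 * A 0 !₂[q.1, q.2, z]) -
          ∫ q : ℝ × ℝ, k q.1 * k q.2 * A 1 !₂[q.1, q.2, z] := by
        have hneg : Integrable fun q : ℝ × ℝ => -(k q.1 * k q.2 * A 0 !₂[q.1, q.2, z]) :=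
          (hIA 0).neg
        rw [integral_sub hneg (hIA 1), integral_neg]
    _ = ∫ q : ℝ × ℝ, k q.1 * k q.2 * (B 0 !₂[q.1, q.2, z] + B 1 !₂[q.1, q.2, z]) := by
        rw [h0, h1, neg_neg, sub_neg_eq_add, ← integral_add (hIB 0) (hIB 1)]
        refine integral_congr_ae (Eventually.of_forall fun q => ?_)
        simp only
        ring

/-! ## The registered tools stub -/

/-- **Harmonic-endgame tools I (registered stub).** Conjunction of the slice identity
`noFastBlowDown_harm_slice_identity` and the two coordinate-translation identities. [folklore] -/
theorem stub_noFastBlowDownHarmonicSliceTools :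
    (∀ (U : EuclideanSpace ℝ (Fin 3) → EuclideanSpace ℝ (Fin 3)),
      ContDiff ℝ ((⊤ : ℕ∞) : WithTop ℕ∞) U → ∀ (k k' : ℝ → ℝ), Continuous k → Continuous k' →
      (∀ t, HasDerivAt k (k' t) t) → (∀ t, t ≤ 0 → k t = 0) → (∀ t, 2 ≤ t → k t = 0) →
      (∀ t, 0 ≤ t → t ≤ 1 → k t + k (t + 1) = 1) → (∀ t, t ≤ 0 → k' t = 0) →
      (∀ t, 2 ≤ t → k' t = 0) → (∀ t, 0 ≤ t → t ≤ 1 → k' t + k' (t + 1) = 0) → ∀ z : ℝ,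
      (∀ x y : ℝ, ∑ i : Fin 3, fderiv ℝ (fun Y => fderiv ℝ U Y (EuclideanSpace.single i (1 : ℝ)))
        !₂[x, y, z] (EuclideanSpace.single i (1 : ℝ)) = 0) →
      (∀ x y : ℝ, U (!₂[x, y, z] + EuclideanSpace.single 0 (1 : ℝ)) = U !₂[x, y, z]) →
      (∀ x y : ℝ, U (!₂[x, y, z] + EuclideanSpace.single 1 (1 : ℝ)) = U !₂[x, y, z]) →
      ∫ q : ℝ × ℝ, k q.1 * k q.2 * inner ℝ (U !₂[q.1, q.2, z])
          (fderiv ℝ (fun Y => fderiv ℝ U Y (EuclideanSpace.single 2 (1 : ℝ))) !₂[q.1, q.2, z]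
            (EuclideanSpace.single 2 (1 : ℝ))) =
        ∫ q : ℝ × ℝ, k q.1 * k q.2 *
          (‖fderiv ℝ U !₂[q.1, q.2, z] (EuclideanSpace.single 0 (1 : ℝ))‖ ^ 2 +
            ‖fderiv ℝ U !₂[q.1, q.2, z] (EuclideanSpace.single 1 (1 : ℝ))‖ ^ 2)) ∧
    (∀ x y z c : ℝ, (!₂[x, y, z] : EuclideanSpace ℝ (Fin 3)) + c • EuclideanSpace.single 0 (1 : ℝ) =
      !₂[x + c, y, z]) ∧
    (∀ x y z c : ℝ, (!₂[x, y, z] : EuclideanSpace ℝ (Fin 3)) + c • EuclideanSpace.single 1 (1 : ℝ) =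
      !₂[x, y + c, z]) :=
  ⟨noFastBlowDown_harm_slice_identity, noFastBlowDown_harm_pt_add_zero,
    noFastBlowDown_harm_pt_add_one⟩

end Summit.AnomalousDissipation.AnomalousDissipation.Theorems

end
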